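import Summits.Langlands.Langlands.Theses.PicardMuOrdinary
import Summits.Langlands.Langlands.Theorems.IrreducibilityBySelfDualityReciprocityUpToIrreducibilityWeakAutomorphy
import Literature.NumberTheory.Automorphic.EssConjSelfDual
import Literature.NumberTheory.Automorphic.ReciprocityGLnProofs
import Literature.NumberTheory.PAdicHodge.FontaineDpst
import Literature.NumberTheory.GaloisRepresentations.PstWeilDeligne
import Literature.NumberTheory.GaloisRepresentations.ResidualGaloisRep
import Literature.NumberTheory.GaloisRepresentations.AbsIrreducibleIndexTwo
import HarnessLib

/-!
# Route `PicardMuOrdinary`, crux `IrregularClassicality` (stmt-Langlands-13758), line `slope-free-polarized-limit` r14: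
# the essential heart H♮ is a NECESSARY condition of the summit `Langlands` (no refutation room)

Continuation lead prover-line-stmt-Langlands-13758-c16-0, 2026-08-17.  The registered research stub H♮ `stub_honestHeartEss`
of skeleton r14 ("a `3`-adically pro-automorphic ESSENTIALLY-`c₀`-polarized, de Rham at `λ`, residually absolutely
irreducible `ρ : Γ_{ℚ(ω)} → GL₃(ℚ̄₃)` is automorphic") follows from the summit statement `Langlands` — precisely from its
direction (B) with the local–global clause dropped, the weak automorphy B_w of
`ReciprocityUpToIrreducibility.stub_weakAutomorphy_of_langlands` at `(K, n, ℓ) = (ℚ(ω), 3, 3)`: residual absolute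
irreducibility gives irreducibility (Darmon–Diamond–Taylor §2.1 + `IsAbsolutelyIrreducible.isIrreducible`), unramifiedness
off the finite `S` gives unramifiedness almost everywhere, the de Rham clause is the pinned one verbatim, and B_w's
almost-everywhere Satake–Frobenius compatibility (`SatakeFrobCompatibleAt`, L-normalisation `m = 1`) is H♮'s conclusion
read off a finite exceptional set.  The tower hypothesis of H♮ is not used: it is the handle for PROOF technology
(`GU(2,1)` eigenvarieties), idle for TRUTH.  So H♮ is conjecture-grade exactly like lang.S03 / the summit: refuting it
refutes `Langlands`.  Nothing here closes the item.

References: J.-M. Fontaine, B. Mazur, *Geometric Galois representations* (1995) Conj. 1; K. Buzzard, T. Gee, *The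
conjectural connections between automorphic representations and Galois representations* (2014) Conj. 3.2.1–3.2.2;
H. Darmon, F. Diamond, R. Taylor (1995) §2.1.
(buildfix 2026-08-20: comment-only re-land to re-enqueue the module build after its blocking imports were repaired; no declaration changed.)
-/

open Literature.NumberTheory.GaloisRepresentations Literature.NumberTheory.Automorphic
open Literature.NumberTheory
open scoped NumberField
open IsDedekindDomain NumberField Polynomial Filter Field

-- `Summit.Langlands.Langlands.…` (summit = sub-problem name, D-0017 layout) trips `dupNamespace` on every decl.
set_option linter.dupNamespace false
set_option autoImplicit false

namespace Summit.Langlands.Langlands.Theorems.IrregularClassicality.SlopeFreePolarizedLimit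

noncomputable section

/-- **H♮ (`stub_honestHeartEss` of skeleton r14, VERBATIM) follows from the summit `Langlands`** (through the weak
automorphy B_w = direction (B) minus local–global compatibility, `stub_weakAutomorphy_of_langlands`): the essential heart
is a necessary condition of the summit, hence admits no refutation short of `¬Langlands`.  The polarized-tower
hypothesis is idle for truth. [cite: FontaineMazurGeometric1995, Conj. 1] [cite: BuzzardGeeLMS2014, Conj. 3.2.2] -/
theorem stub_honestHeartEss_of_langlands : _root_.Langlands → (∀ (hcpt : isCompact_glFiniteIntegralLevel 3 (CyclotomicField 3 ℚ)) (ι : PadicAlgCl 3 ≃+* ℂ) (c₀ : (CyclotomicField 3 ℚ) ≃ₐ[ℚ] (CyclotomicField 3 ℚ)) (S : Finset (HeightOneSpectrum (𝓞 (CyclotomicField 3 ℚ)))) (ρ : FramedGaloisRep (CyclotomicField 3 ℚ) (PadicAlgCl 3) 3), c₀ ≠ 1 → (∀ v : HeightOneSpectrum (𝓞 (CyclotomicField 3 ℚ)), ((3 : ℕ) : 𝓞 (CyclotomicField 3 ℚ)) ∈ v.asIdeal → v ∈ S) → ρ.IsResiduallyAbsIrreducible → (∀ (v : HeightOneSpectrum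 (𝓞 (CyclotomicField 3 ℚ))) (hv : ((3 : ℕ) : 𝓞 (CyclotomicField 3 ℚ)) ∈ v.asIdeal), (PAdicHodge.fontainePstAdicCompletion v 3 hv).IsDeRhamFramed (ρ.toLocal v)) → (∀ 𝔭 ∉ S, ρ.IsUnramifiedAt 𝔭) → (∀ k : ℕ, ∃ (P : CuspidalAutomorphicRepData 3 (CyclotomicField 3 ℚ) hcpt) (r : FramedGaloisRep (CyclotomicField 3 ℚ) (PadicAlgCl 3) 3) (χ : Literature.NumberTheory.GaloisRepresentations.HeckeCharacter (CyclotomicField 3 ℚ)), P.1.IsRegularAlgebraic ∧ P.1.IsGalConjEssSelfDual c₀ χ ∧ ∀ 𝔭 ∉ S, P.1.IsUnramifiedAt 𝔭 ∧ IsGaloisCompatibleAt P.1 ι r 𝔭 ∧ ∃ α : Multiset ℂ, P.1.HasSatakeParamAt 𝔭 α ∧ ∀ 𝔓 ∈ 𝔭.primesAbove, ∀ τ : absoluteGaloisGroup (CyclotomicField 3 ℚ), IsArithFrobAt (𝓞 (CyclotomicField 3 ℚ)) τ 𝔓 → ‖ι.symm ((𝔭.residueCard : ℂ) * α.sum) -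 FramedRep.trace ρ τ⁻¹‖ ≤ ((3 : ℝ)⁻¹) ^ k) → ∃ (π' : CuspidalAutomorphicRepData 3 (CyclotomicField 3 ℚ) hcpt) (S' : Finset (HeightOneSpectrum (𝓞 (CyclotomicField 3 ℚ)))), π'.1.IsLAlgebraic ∧ ∀ 𝔭 ∉ S', ∃ α : Multiset ℂ, π'.1.HasSatakeParamAt 𝔭 α ∧ ρ.IsUnramifiedAt 𝔭 ∧ ρ.HasFrobCharpolyAt 𝔭 (arithFrobPolyOfSatake ι 𝔭.residueCard 1 α)) := by
  intro hL hcpt ι c₀ S ρ _hc₀ _hS3 hres hdR hunr _htower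
  classical
  -- irreducibility from residual absolute irreducibility (Darmon–Diamond–Taylor §2.1)
  have habs : FramedRep.IsAbsolutelyIrreducible ρ :=
    FramedGaloisRep.IsResiduallyAbsIrreducible.isAbsolutelyIrreducible (by norm_num) hres
  have hirr : ρ.toGaloisRep.IsIrreducible := habs.isIrreducible
  -- unramified almost everywhere
  have hunr' : ∀ᶠ v : HeightOneSpectrum (𝓞 (CyclotomicField 3 ℚ)) in cofinite, ρ.IsUnramifiedAt v :=
    S.eventually_cofinite_notMem.mono fun v hv => hunr v hv
  -- B_w at (ℚ(ω), 3, 3)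
  haveI : Fact (Nat.Prime 3) := ⟨Nat.prime_three⟩
  obtain ⟨π, hLalg, hcompat⟩ :=
    ReciprocityUpToIrreducibility.stub_weakAutomorphy_of_langlands hL (CyclotomicField 3 ℚ) 3 hcpt (by norm_num) 3 ι ρ
      hirr ⟨hunr', hdR⟩
  -- read the a.e. compatibility off a finite exceptional set
  have hfin : {v : HeightOneSpectrum (𝓞 (CyclotomicField 3 ℚ)) | ¬ SatakeFrobCompatibleAt ι π.1 ρ v}.Finite :=
    Filter.eventually_cofinite.1 hcompat
  refine ⟨π, hfin.toFinset, hLalg, fun 𝔭 h𝔭 => ?_⟩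
  have h : SatakeFrobCompatibleAt ι π.1 ρ 𝔭 := by
    by_contra hc
    exact h𝔭 (hfin.mem_toFinset.2 hc)
  exact h

end

end Summit.Langlands.Langlands.Theorems.IrregularClassicality.SlopeFreePolarizedLimit
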